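import Literature.AnabelianGeometry.SemiGraphs.ArithLevelDataCptOfChart
import Literature.AnabelianGeometry.SemiGraphs.ArithDictionariesOfCosetTower
import Literature.AnabelianGeometry.SemiGraphs.ImmersionLiftUnique
import HarnessLib

/-!
# [SemiAnbd] Thm 5.4 producer T54-B: the compact-form arithmetic level data of the chart-produced
# decomposition data INSTANTIATED at abc-iut-L3-d4's coset-graph tower (`ArithLevelDataCpt.ofCosetTower`)

Mochizuki, *Semi-graphs of anabelioids*, Publ. RIMS **42** (2006), §5 pp. 62–66 (Def 5.1 (i), p. 65,
Thm 5.4 (i) p. 66 with the proof of Thm 3.7 (iii) p. 41 and the author's Comments (6)), kurims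
`paper:url-f33ace170ff4`. [cite: MochizukiSemiAnbd2006, Thm 5.4 (i), p. 66]

PACKAGING, producer row T54-B (GAP-LEDGER G-w4d053-1; abc-iut-w4-d053, owner of `ArithLevelData(Cpt)`):
the v2 constructor `ArithLevelDataCpt.ofChartEdgeData` (ArithLevelDataCptOfChart.lean) INSTANTIATED at
the coset-graph tower of a subgroup presentation `P` of `𝒢.graph` in `π₁^temp(𝒢)` (abc-iut-L3-d4,
SubgroupPresentationCosetGraph/ArithAction.lean): trees `P.cosetGraph (K j)` (tree levels `K j`, normal,
antitone, `Φ`-stable), arithmetic actions `P.arithAct hP (K j)`, transitions `P.cosetGraphTrans`, finite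
levels `P.cosetGraph (L j)` for FINITE-INDEX levels `L j ⊇ K j` with the transition `K j ≤ L j` as the
graph-covering — an IMMERSION as soon as `L j ∩ z⁻¹ H_w z ≤ K j` (`cosetGraphTrans_isImmersion`; the
shape of "`K j` is the kernel of the universal graph-covering of the level `L j`") —, and the TWO-SIDED
dictionaries (I1)–(I3) DISCHARGED by abc-iut-w4-d059's «T54-B-dict2» through
`hfixN/hstabN/hedgeN/hedgeFixN_of_cosetTower` (ArithDictionariesOfCosetTower.lean).  What remains as
BINDERS — the residual producer contract of T54-B on this route —: the presentation data (`hP :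
IsArithCompatible`, `hPH`/`hPM`: its groups are §3 representatives), the algebraic tower inputs
`hHK`/`hMK`/`hlift`/`hliftE` of dict2 (topological discharge = abc-iut-w4-d085's (P-K)), the level
families with `hfree`, trees (`hT`), open kernels of the arithmetic actions in the chosen topology
(`hKopen`; abc-iut-L3-d2's tempered topology has the level kernels open), the printed hypothesis
`noSwitchBase`, the estrangement consequence `hnobpN` at the finite levels, and (AI4″)
`stabBranchPairAug` (abc-iut-w4-d059, producer).

Helper facts proved here (coset-graph bookkeeping over abc-iut-L3-d4's T1a): `cosetGraph_isGraph` (the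
coset graph of a graph is a graph), `cosetGraphTrans_isImmersion`, `finite_cosetGraph_vertex/branch`
(finite-index levels of a finite graph give finite coset graphs).  A DEFINITION assembling binders: nothing
is asserted; typed ≠ proved; no side taken on [IUTchIII] Cor 3.12.
-/

namespace Literature.AnabelianGeometry.SemiGraphs

open CategoryTheory
open scoped Pointwise

universe u v w

/-! ### Coset-graph bookkeeping -/

namespace SemiGraph

namespace SubgroupPresentation

variable {𝔾 : SemiGraph.{u}} {Γ : Type u} [Group Γ] (P : SubgroupPresentation 𝔾 Γ)

/-- The coset graph of a GRAPH is a graph: the branch `(b, M_e y K)` abuts to `H_w s_b y K` where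
`b` abuts to `w`. [cite: MochizukiSemiAnbd2006, Thm 3.7(iii) p.41] -/
theorem cosetGraph_isGraph (hG : 𝔾.IsGraph) (K : Subgroup Γ) : (P.cosetGraph K).IsGraph := by
  refine ⟨fun x => ?_⟩
  obtain ⟨b, y, rfl⟩ := P.bMk_surjective K x
  obtain ⟨w, hw⟩ := Option.isSome_iff_exists.mp (hG.abuts_isSome b)
  rw [P.cosetGraph_abuts_bMk K b w hw y]
  rfl

/-- **The transition `P.cosetGraph K ⟶ P.cosetGraph L` is an IMMERSION** when `L ∩ z⁻¹ H_w z ≤ K` for all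
`w`, `z` (the level `K` is at least as deep as the kernel of the universal graph-covering of the level
`L`: no element of `L` outside `K` fixes a vertex of the `K`-coset graph).  Two branches `(b, M_e yᵢ K)` at
one vertex `H_w z K` with the same image `M_e y₁ L = M_e y₂ L` differ by `l ∈ L ∩ z⁻¹ H_w z`, up to `K`.
[cite: MochizukiSemiAnbd2006, Thm 3.7(iii) p.41] -/
theorem cosetGraphTrans_isImmersion {K L : Subgroup Γ} [K.Normal] (hKL : K ≤ L)
    (hfree : ∀ (w : 𝔾.Vertex) (z x : Γ), x ∈ L → z * x * z⁻¹ ∈ P.H w → x ∈ K) :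
    IsImmersion (P.cosetGraphTrans hKL) := by
  intro X
  obtain ⟨w, z, rfl⟩ := P.vMk_surjective K X
  rintro ⟨B₁, hB₁⟩ ⟨B₂, hB₂⟩ h
  obtain ⟨b₁, y₁, rfl⟩ := P.bMk_surjective K B₁
  obtain ⟨b₂, y₂, rfl⟩ := P.bMk_surjective K B₂
  -- same branch label and same `L`-class
  have h' : P.bMk L b₁ y₁ = P.bMk L b₂ y₂ := congrArg Subtype.val h
  have hb : b₁ = b₂ := congrArg (fun B : (P.cosetGraph L).Branch => B.1.1) h'
  subst hb
  have hL : DoubleCoset.mk (P.M (𝔾.edgeOf b₁)) L y₁ = DoubleCoset.mk (P.M (𝔾.edgeOf b₁)) L y₂ := by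
    have := congrArg (fun B : (P.cosetGraph L).Branch => B.1.2) h'
    exact eq_of_heq (Sigma.mk.inj this).2
  -- abutments: `b₁` abuts to `w` in `𝔾`, and `H_w s_b yᵢ K = H_w z K`
  have hw : 𝔾.abuts b₁ = some w := by
    rcases hbw : 𝔾.abuts b₁ with _ | w'
    · rw [P.cosetGraph_abuts_bMk_none K b₁ hbw y₁] at hB₁
      exact (Option.some_ne_none _ hB₁.symm).elim
    · rw [P.cosetGraph_abuts_bMk K b₁ w' hbw y₁] at hB₁
      have := congrArg Sigma.fst (Option.some_injective _ hB₁)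
      exact congrArg some this
  have hv₁ : DoubleCoset.mk (P.H w) K (P.s b₁ * y₁) = DoubleCoset.mk (P.H w) K z := by
    rw [P.cosetGraph_abuts_bMk K b₁ w hw y₁] at hB₁
    exact (P.vMk_eq_vMk_iff K).1 (Option.some_injective _ hB₁)
  have hv₂ : DoubleCoset.mk (P.H w) K (P.s b₁ * y₂) = DoubleCoset.mk (P.H w) K z := by
    rw [P.cosetGraph_abuts_bMk K b₁ w hw y₂] at hB₂
    exact (P.vMk_eq_vMk_iff K).1 (Option.some_injective _ hB₂)
  -- `y₂ = m y₁ l` with `m ∈ M_e`, `l ∈ L`; `s_b yᵢ = hᵢ z kᵢ`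
  obtain ⟨m, hm, l, hl, hy₂⟩ := (DoubleCoset.eq _ _ _ _).1 hL
  obtain ⟨h₁, hh₁, k₁, hk₁, hz₁⟩ := (DoubleCoset.eq _ _ _ _).1 hv₁
  obtain ⟨h₂, hh₂, k₂, hk₂, hz₂⟩ := (DoubleCoset.eq _ _ _ _).1 hv₂
  -- it suffices that `l ∈ K`
  apply Subtype.ext
  change P.bMk K b₁ y₁ = P.bMk K b₁ y₂
  suffices hlK : l ∈ K by
    have : DoubleCoset.mk (P.M (𝔾.edgeOf b₁)) K y₁ = DoubleCoset.mk (P.M (𝔾.edgeOf b₁)) K y₂ :=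
      (DoubleCoset.eq _ _ _ _).2 ⟨m, hm, l, hlK, hy₂⟩
    exact Subtype.ext (Prod.ext rfl (congrArg (Sigma.mk _) this))
  -- `n := s_b m s_b⁻¹ ∈ H_w`; `B := k₁⁻¹ l k₂ ∈ L` and `z B z⁻¹ ∈ H_w`, hence `B ∈ K` by `hfree`
  have hn : P.s b₁ * m * (P.s b₁)⁻¹ ∈ P.H w := P.conj_mem b₁ w hw m hm
  have hB : k₁⁻¹ * l * k₂ ∈ L := L.mul_mem (L.mul_mem (L.inv_mem (hKL hk₁)) hl) (hKL hk₂)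
  have e1 : P.s b₁ * y₁ = h₁⁻¹ * z * k₁⁻¹ := by rw [hz₁]; group
  have e3 : z = (h₂ * (P.s b₁ * m * (P.s b₁)⁻¹) * h₁⁻¹) * z * (k₁⁻¹ * l * k₂) := by
    conv_lhs => rw [hz₂, hy₂]
    rw [show h₂ * (P.s b₁ * (m * y₁ * l)) * k₂ =
        h₂ * (P.s b₁ * m * (P.s b₁)⁻¹) * (P.s b₁ * y₁) * l * k₂ by group, e1]
    group
  have hzB : z * (k₁⁻¹ * l * k₂) * z⁻¹ ∈ P.H w := by
    have : z * (k₁⁻¹ * l * k₂) * z⁻¹ = (h₂ * (P.s b₁ * m * (P.s b₁)⁻¹) * h₁⁻¹)⁻¹ := by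
      have h4 : (h₂ * (P.s b₁ * m * (P.s b₁)⁻¹) * h₁⁻¹)⁻¹ * z = z * (k₁⁻¹ * l * k₂) := by
        conv_lhs => rw [e3]
        group
      rw [← h4]; group
    rw [this]
    exact (P.H w).inv_mem ((P.H w).mul_mem ((P.H w).mul_mem hh₂ hn) ((P.H w).inv_mem hh₁))
  have hBK : k₁⁻¹ * l * k₂ ∈ K := hfree w z _ hB hzB
  have : l = k₁ * (k₁⁻¹ * l * k₂) * k₂⁻¹ := by group
  rw [this]
  exact K.mul_mem (K.mul_mem hk₁ hBK) (K.inv_mem hk₂)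

/-- The coset graph at a FINITE-INDEX level of a graph with finitely many vertices has finitely many
vertices. [cite: MochizukiSemiAnbd2006, Thm 3.7(iii) p.41] -/
theorem finite_cosetGraph_vertex (L : Subgroup Γ) [Finite 𝔾.Vertex] [Finite (Γ ⧸ L)] :
    Finite (P.cosetGraph L).Vertex := by
  haveI : ∀ w : 𝔾.Vertex, Finite (P.VClass L w) := fun w => by
    refine Finite.of_surjective (fun q : Γ ⧸ L => DoubleCoset.mk (P.H w) L q.out) ?_
    intro x
    induction x using Quotient.inductionOn' with
    | h y =>
      refine ⟨QuotientGroup.mk y, ?_⟩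
      change DoubleCoset.mk (P.H w) L _ = DoubleCoset.mk (P.H w) L y
      rw [DoubleCoset.eq]
      refine ⟨1, (P.H w).one_mem, ((QuotientGroup.mk y : Γ ⧸ L).out)⁻¹ * y, ?_, by group⟩
      rw [← QuotientGroup.eq, QuotientGroup.out_eq']
  show Finite (Σ w : 𝔾.Vertex, P.VClass L w)
  infer_instance

/-- The coset graph at a FINITE-INDEX level of a graph with finitely many branches has finitely many
branches. [cite: MochizukiSemiAnbd2006, Thm 3.7(iii) p.41] -/
theorem finite_cosetGraph_branch (L : Subgroup Γ) [Finite 𝔾.Branch] [Finite (Γ ⧸ L)] :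
    Finite (P.cosetGraph L).Branch := by
  haveI : Finite 𝔾.Edge := finite_edge_of_finite_branch 𝔾
  haveI : ∀ e : 𝔾.Edge, Finite (P.EClass L e) := fun e => by
    refine Finite.of_surjective (fun q : Γ ⧸ L => DoubleCoset.mk (P.M e) L q.out) ?_
    intro x
    induction x using Quotient.inductionOn' with
    | h y =>
      refine ⟨QuotientGroup.mk y, ?_⟩
      change DoubleCoset.mk (P.M e) L _ = DoubleCoset.mk (P.M e) L y
      rw [DoubleCoset.eq]
      refine ⟨1, (P.M e).one_mem, ((QuotientGroup.mk y : Γ ⧸ L).out)⁻¹ * y, ?_, by group⟩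
      rw [← QuotientGroup.eq, QuotientGroup.out_eq']
  show Finite {p : 𝔾.Branch × (Σ e : 𝔾.Edge, P.EClass L e) // p.2.1 = 𝔾.edgeOf p.1}
  infer_instance

end SubgroupPresentation

end SemiGraph

/-! ### The instantiation at the coset-graph tower -/

namespace ProfiniteSemiGraph

variable {𝒢 : ProfiniteSemiGraph.{u}} (c : TemperedPiChart 𝒢)

/-- **The compact-form arithmetic level data of the chart-produced decomposition data, AT THE COSET-GRAPH
TOWER** ([SemiAnbd] Thm 5.4 (i) p. 66 / p. 65 / proof of Thm 3.7 (iii) p. 41): `ArithLevelDataCpt.ofChartEdgeData`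
instantiated with trees `P.cosetGraph (K j)`, arithmetic actions `P.arithAct hP (K j)`, transitions
`P.cosetGraphTrans`, finite levels `P.cosetGraph (L j)` (finite-index levels `L j ⊇ K j`, the
transition being the graph-covering, an immersion by `hfree`), and the TWO-SIDED dictionaries (I1)–(I3)
DISCHARGED from abc-iut-w4-d059's «T54-B-dict2» (`hfixN/hstabN/hedgeN/hedgeFixN_of_cosetTower`).
Binders: the presentation (`hP`, `hPH`, `hPM`), dict2's algebraic tower inputs `hHK`/`hMK`/`hlift`/`hliftE`,
the level families (`K`, `L`, `hfree`), trees `hT`, open kernels `hKopen`, the printed hypothesis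
`noSwitchBase`, `hnobpN` at the finite levels, and (AI4″) `stabBranchPairAug`.  Nothing asserted.
[cite: MochizukiSemiAnbd2006, Thm 5.4 (i), p. 66] -/
noncomputable def _root_.Literature.AnabelianGeometry.SemiGraphs.ArithLevelDataCpt.ofCosetTower
    (h𝒢 : 𝒢.Thm37Hypotheses) (hG : 𝒢.graph.IsGraph) [Finite 𝒢.graph.Vertex] [Finite 𝒢.graph.Branch]
    (R : ChartRepresentatives c)
    {E : Type w} [Group E] [TopologicalSpace E] {PA : Type v} [Group PA]
    (ι : c.G →* E) (hι : Function.Injective ι) (hnorm : (ι.range).Normal)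
    (aug : E →* PA) (baseAct : PA →* Aut 𝒢.graph)
    -- the subgroup presentation and its compatibility with the outer action (abc-iut-L3-d4)
    (P : SemiGraph.SubgroupPresentation 𝒢.graph c.G) {Φ : E →* MulAut c.G}
    (hP : P.IsArithCompatible Φ (baseAct.comp aug))
    (hιΦ : ∀ g : c.G, Φ (ι g) = MulAut.conj g) (hισ : ∀ g : c.G, (baseAct.comp aug) (ι g) = 1)
    (hPH : ∀ w, P.H w ∈ verticialSubgroups c w) (hPM : ∀ e, P.M e ∈ edgeLikeSubgroups c e)
    (w₀ : 𝒢.graph.Vertex)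
    -- the tree levels
    (K : ℕ → Subgroup c.G) [∀ j, (K j).Normal] (hK : ∀ ⦃i j : ℕ⦄, i ≤ j → K j ≤ K i)
    (hKst : ∀ (j : ℕ) (e : E) (x : c.G), x ∈ K j → Φ e x ∈ K j)
    (hT : ∀ j, (P.cosetGraph (K j)).IsTree)
    (hKopen : ∀ j, IsOpen ((P.arithAct hP (K j) (hKst j)).ker : Set E))
    -- Thm 5.4's printed frame hypothesis on the base
    (noSwitchBase : NoBranchSwitching 𝒢.graph.edgeOf
      (fun (a : PA) (b : 𝒢.graph.Branch) => (baseAct a).hom.branchMap b))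
    -- abc-iut-w4-d059's dict2 algebraic tower inputs (topological discharge: abc-iut-w4-d085 (P-K))
    (hHK : ∀ (w : 𝒢.graph.Vertex) (x : c.G), (∀ j, x ∈ (P.H w : Set c.G) * (K j : Set c.G)) → x ∈ P.H w)
    (hMK : ∀ (e : 𝒢.graph.Edge) (x : c.G), (∀ j, x ∈ (P.M e : Set c.G) * (K j : Set c.G)) → x ∈ P.M e)
    (hlift : ∀ (w : 𝒢.graph.Vertex) (y : ℕ → c.G),
      (∀ ⦃i j : ℕ⦄, i ≤ j →
        DoubleCoset.mk (P.H w) (K i) (y j) = DoubleCoset.mk (P.H w) (K i) (y i)) →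
      ∃ z : c.G, ∀ j, DoubleCoset.mk (P.H w) (K j) z = DoubleCoset.mk (P.H w) (K j) (y j))
    (hliftE : ∀ (j₁ : ℕ) (e : 𝒢.graph.Edge) (y : {j : ℕ // j₁ ≤ j} → c.G),
      (∀ ⦃i j : {j : ℕ // j₁ ≤ j}⦄, i.1 ≤ j.1 →
        DoubleCoset.mk (P.M e) (K i.1) (y j) = DoubleCoset.mk (P.M e) (K i.1) (y i)) →
      ∃ z : c.G, ∀ j, DoubleCoset.mk (P.M e) (K j.1) z = DoubleCoset.mk (P.M e) (K j.1) (y j))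
    -- the finite levels
    (L : ℕ → Subgroup c.G) [∀ j, (L j).Normal] [∀ j, Finite (c.G ⧸ L j)]
    (hL : ∀ ⦃i j : ℕ⦄, i ≤ j → L j ≤ L i)
    (hLst : ∀ (j : ℕ) (e : E) (x : c.G), x ∈ L j → Φ e x ∈ L j) (hKL : ∀ j, K j ≤ L j)
    (hfree : ∀ (j : ℕ) (w : 𝒢.graph.Vertex) (z x : c.G), x ∈ L j → z * x * z⁻¹ ∈ P.H w → x ∈ K j)
    -- the estrangement consequence at the finite levels (abc-iut-L3-t11's shape)
    (hnobpN : ∀ (C : Subgroup c.G) (j₀ : ℕ) (w : ∀ i : {i : ℕ // j₀ ≤ i}, (P.cosetGraph (L i.1)).Vertex)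
      (β β' : ∀ i : {i : ℕ // j₀ ≤ i}, (P.cosetGraph (L i.1)).Branch),
      (∀ i, β i ≠ β' i ∧ (P.cosetGraph (L i.1)).abuts (β i) = some (w i) ∧
        (P.cosetGraph (L i.1)).abuts (β' i) = some (w i)) →
      (∀ ⦃i i' : {i : ℕ // j₀ ≤ i}⦄ (h : i.1 ≤ i'.1), (P.cosetGraphTrans (hL h)).vertexMap (w i') = w i ∧
        (P.cosetGraphTrans (hL h)).branchMap (β i') = β i ∧
          (P.cosetGraphTrans (hL h)).branchMap (β' i') = β' i) →
      (∀ (i : {i : ℕ // j₀ ≤ i}) (γ : C), (P.arithAct hP (L i.1) (hLst i.1) (ι γ)).hom.vertexMap (w i) = w i ∧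
        (P.arithAct hP (L i.1) (hLst i.1) (ι γ)).hom.branchMap (β i) = β i ∧
          (P.arithAct hP (L i.1) (hLst i.1) (ι γ)).hom.branchMap (β' i) = β' i) → C = ⊥)
    -- (AI4″) at the finite levels (abc-iut-w4-d059, producer)
    (stabBranchPairAug : ∀ (C : Subgroup E), IsCompact (C : Set E) →
      ∀ (j₀ : ℕ) (w : ∀ i : {i : ℕ // j₀ ≤ i}, (P.cosetGraph (L i.1)).Vertex)
      (β β' : ∀ i : {i : ℕ // j₀ ≤ i}, (P.cosetGraph (L i.1)).Branch),
      (∀ i, β i ≠ β' i ∧ (P.cosetGraph (L i.1)).abuts (β i) = some (w i) ∧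
        (P.cosetGraph (L i.1)).abuts (β' i) = some (w i)) →
      (∀ ⦃i i' : {i : ℕ // j₀ ≤ i}⦄ (h : i.1 ≤ i'.1), (P.cosetGraphTrans (hL h)).vertexMap (w i') = w i ∧
        (P.cosetGraphTrans (hL h)).branchMap (β i') = β i ∧
          (P.cosetGraphTrans (hL h)).branchMap (β' i') = β' i) →
      (∀ (i : {i : ℕ // j₀ ≤ i}) (g : E), g ∈ C →
        (P.arithAct hP (L i.1) (hLst i.1) g).hom.vertexMap (w i) = w i ∧
        (P.arithAct hP (L i.1) (hLst i.1) g).hom.branchMap (β i) = β i ∧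
          (P.arithAct hP (L i.1) (hLst i.1) g).hom.branchMap (β' i) = β' i) →
      ∃ (v : 𝒢.graph.Vertex) (b b' : 𝒢.graph.Branch) (a : PA) (h : E),
        (decompositionDataOfChart R ι).abut b = some v ∧ (decompositionDataOfChart R ι).abut b' = some v ∧
        h ∈ (decompositionDataOfChart R ι).vertGp v ∧ (b' ≠ b ∨ h ∉ (decompositionDataOfChart R ι).brGp b) ∧
        C.map aug ≤ conjSubgroup a (((decompositionDataOfChart R ι).brGp b ⊓
          conjSubgroup h ((decompositionDataOfChart R ι).brGp b')).map aug)) :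
    ArithLevelDataCpt 𝒢.graph (decompositionDataOfChart R ι) aug baseAct :=
  haveI : ∀ j, Finite (P.cosetGraph (L j)).Vertex := fun j => P.finite_cosetGraph_vertex (L j)
  haveI : ∀ j, Finite (P.cosetGraph (L j)).Branch := fun j => P.finite_cosetGraph_branch (L j)
  ArithLevelDataCpt.ofChartEdgeData h𝒢 hG R ι hι hnorm aug baseAct
    (tree := fun j => P.cosetGraph (K j)) (isTree := hT) (isGraph := fun j => P.cosetGraph_isGraph hG (K j))
    (vertex := fun j => P.vMk (K j) w₀ 1) (proj := fun j => P.cosetGraphProj (K j))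
    (act := fun j => P.arithAct hP (K j) (hKst j)) (isOpen_ker := hKopen)
    (act_proj := fun j g => P.arithAct_comp_proj hP (K j) (hKst j) g)
    (noSwitchBase := noSwitchBase)
    (trans := fun _ _ h => P.cosetGraphTrans (hK h))
    (trans_id := fun j => P.cosetGraphTrans_refl (K j))
    (trans_comp := fun _ _ _ hij hjk => P.cosetGraphTrans_comp (hK hjk) (hK hij))
    (trans_over := fun _ _ h => P.cosetGraphTrans_comp_proj (hK h))
    (trans_act := fun _ _ h g => P.arithAct_trans hP (hKst _) (hKst _) (hK h) g)
    (hfixN := hfixN_of_cosetTower c P hP ι hιΦ hισ K hK hKst hPH hHK)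
    (hstabN := hstabN_of_cosetTower c P hP ι hιΦ hισ K hK hKst hPH hHK hlift)
    (hedgeN := hedgeN_of_cosetTower c P hP ι hιΦ hισ K hK hKst hPM hMK hliftE)
    (hedgeFixN := hedgeFixN_of_cosetTower c P hP ι hιΦ hισ K hK hKst hPM hMK hT hG)
    (level := fun j => P.cosetGraph (L j))
    (quot := fun j => P.cosetGraphTrans (hKL j))
    (quot_isImmersion := fun j => P.cosetGraphTrans_isImmersion (hKL j) (hfree j))
    (levelAct := fun j => P.arithAct hP (L j) (hLst j))
    (act_quot := fun j g => P.arithAct_trans hP (hKst j) (hLst j) (hKL j) g)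
    (levelTrans := fun _ _ h => P.cosetGraphTrans (hL h))
    (levelTrans_id := fun j => P.cosetGraphTrans_refl (L j))
    (levelTrans_comp := fun _ _ _ hij hjk => P.cosetGraphTrans_comp (hL hjk) (hL hij))
    (levelTrans_act := fun _ _ h g => P.arithAct_trans hP (hLst _) (hLst _) (hL h) g)
    (trans_quot := fun _ _ h => by rw [P.cosetGraphTrans_comp, P.cosetGraphTrans_comp])
    (hnobpN := hnobpN) (stabBranchPairAug := stabBranchPairAug)

end ProfiniteSemiGraph

end Literature.AnabelianGeometry.SemiGraphs
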